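import Literature.Topology.FourManifolds.TwoChartZones
import Mathlib.Geometry.Manifold.PartitionOfUnity
import HarnessLib

/-!
# A smooth bump which is `1` on a chart ball and supported in a larger chart ball

General bookkeeping (topic `Literature/Topology/FourManifolds`; everything PROVED, no
definitions) for the assembly of the tube of `Σ̄₂ ⊂ T⁴ # ℂℙ²bar` (Akhmedov–Park, Invent. Math.
181 (2010), §3): on a compact surface `F` with a chart `e` of full target and complex coordinate
`A = cx ∘ e`, for radii `R₂ < R₃′ < R₃` there is a smooth `χ : F → [0, 1]` with `χ = 1` on
`{‖A‖ ≤ R₂}` and `tsupport χ ⊆ {p ∈ e.source | ‖A p‖ < R₃}` (`exists_chartBall_bump`, from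
Mathlib's smooth Urysohn lemma `exists_contMDiffMap_zero_one_of_isClosed`).  It localises the
radial factor of the fibre multipliers (`FramingRadialExtension.lean`).

## References

* J. M. Lee, *Introduction to Smooth Manifolds*, 2nd ed. (2013), Prop. 2.25. [LeeSmoothManifolds2013]
-/

noncomputable section

open scoped Manifold ContDiff Topology
open Set Function Metric

namespace Literature.Topology.FourManifolds

namespace ChartBallBump

variable {F : Type} [TopologicalSpace F] [T2Space F] [CompactSpace F]
  [ChartedSpace (EuclideanSpace ℝ (Fin 2)) F] [IsManifold (𝓡 2) ∞ F]
  {cx : EuclideanSpace ℝ (Fin 2) → ℂ}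
  {e : OpenPartialHomeomorph F (EuclideanSpace ℝ (Fin 2))} {A : F → ℂ}

/-- **Smooth bump adapted to chart balls.** [cite: LeeSmoothManifolds2013, Prop. 2.25] -/
theorem exists_chartBall_bump (hcx : ∀ v, cx v = ⟨v 0, v 1⟩) (het : e.target = univ)
    (hA : ∀ p, A p = cx (e p)) {R₂ R₃' R₃ : ℝ} (h23 : R₂ < R₃') (h33 : R₃' < R₃) :
    ∃ χ : F → ℝ, ContMDiff (𝓡 2) 𝓘(ℝ, ℝ) ∞ χ ∧ (∀ p, 0 ≤ χ p ∧ χ p ≤ 1) ∧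
      (∀ p ∈ e.source, ‖A p‖ ≤ R₂ → χ p = 1) ∧
      tsupport χ ⊆ {p | p ∈ e.source ∧ ‖A p‖ < R₃} := by
  -- the two closed sets
  have hsrc : e.symm.source = univ := by rw [e.symm_source, het]
  have hopen : IsOpen (e.symm '' ball (0 : EuclideanSpace ℝ (Fin 2)) R₃') :=
    e.symm.isOpen_image_of_subset_source isOpen_ball (by rw [hsrc]; exact subset_univ _)
  have hs : IsClosed (e.symm '' ball (0 : EuclideanSpace ℝ (Fin 2)) R₃')ᶜ := hopen.isClosed_compl
  have ht : IsClosed (e.symm '' closedBall (0 : EuclideanSpace ℝ (Fin 2)) R₂) :=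
    (TwoChartZones.isCompact_symm_image_closedBall het R₂).isClosed
  have hK : IsClosed (e.symm '' closedBall (0 : EuclideanSpace ℝ (Fin 2)) R₃') :=
    (TwoChartZones.isCompact_symm_image_closedBall het R₃').isClosed
  have hsub : e.symm '' closedBall (0 : EuclideanSpace ℝ (Fin 2)) R₂ ⊆
      e.symm '' ball (0 : EuclideanSpace ℝ (Fin 2)) R₃' :=
    image_mono (closedBall_subset_ball h23)
  have hd : Disjoint (e.symm '' ball (0 : EuclideanSpace ℝ (Fin 2)) R₃')ᶜ
      (e.symm '' closedBall (0 : EuclideanSpace ℝ (Fin 2)) R₂) :=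
    disjoint_compl_left.mono_right hsub
  obtain ⟨g, hg0, hg1, hg01⟩ := exists_contMDiffMap_zero_one_of_isClosed (𝓡 2) (n := (⊤ : ℕ∞)) hs ht hd
  refine ⟨g, g.contMDiff, fun p => ⟨(hg01 p).1, (hg01 p).2⟩, fun p hp hR => ?_, ?_⟩
  · exact hg1 ((TwoChartZones.mem_symm_image_closedBall_iff hcx het hA).2 ⟨hp, hR⟩)
  · -- `tsupport g ⊆ closure (e⁻¹ B(R₃′)) ⊆ e⁻¹ B̄(R₃′) ⊆ {‖A‖ ≤ R₃′} ⊆ {‖A‖ < R₃}`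
    have hsupp : Function.support g ⊆ e.symm '' ball (0 : EuclideanSpace ℝ (Fin 2)) R₃' := by
      intro p hp
      by_contra h
      exact hp (hg0 h)
    have hts : tsupport g ⊆ e.symm '' closedBall (0 : EuclideanSpace ℝ (Fin 2)) R₃' :=
      (closure_mono (hsupp.trans (image_mono ball_subset_closedBall))).trans (hK.closure_subset_iff.2 le_rfl)
    intro p hp
    obtain ⟨hps, hle⟩ := (TwoChartZones.mem_symm_image_closedBall_iff hcx het hA).1 (hts hp)
    exact ⟨hps, lt_of_le_of_lt hle h33⟩

end ChartBallBump

end Literature.Topology.FourManifolds
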